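import Summits.ResolutionOfSingularities.ResolutionOfSingularities.Theorems.FrobeniusLadderFInjectiveMacaulayficationProp44InvariantsDim
import Literature.AlgebraicGeometry.Resolution.NearPointsPointCentreLineCurve
import Literature.AlgebraicGeometry.Resolution.StrictTransformGenericPoint
import Literature.AlgebraicGeometry.Resolution.MaximalPoints
import HarnessLib

/-!
# [CoP1] Prop. 4.4, REACH phase — census row ρ1′ `pointStep_curves'`: the curves of `Σ′` after the blowing up of a closed threefold point
# (Lemma 4.3 (1), (3), (5): strict transforms, or the regular line of near points)

[L1 W4.5a · crux `FInjectiveMacaulayfication` (stmt-ResolutionOfSingularities-15315); D-0154 (2) RES inputs cell, seat res-inputs-p-5a g2;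
critic R41 (3) / R49 / R51 (1): residual oracle ρ1 of the REACH decomposition `plan/inputs/candidates/F71_REACH_DECOMPOSITION_SIGNATURE_p5a.lean`
(v2 404fd483126153cf), RESHAPED to ρ1′ (bus 2026-08-28T09:46:49Z, p-8b concurring 09:49:02Z): the final clause «`η″ = η′`» (uniqueness of
the line, which needs the exceptional fibre as `ℙ²`) is replaced by «`η″ = η′ ∨` the closures are disjoint», which is what the REACH loop
consumes (T2a′'s transversality between two new curves is then vacuous). All other binders are ρ1's VERBATIM. PROVED, def-free, fact-free;
not a statement of the manuscript under adjudication; AI-written, AI review weaker than expert review.]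

Cossart–Piltant 2008, proof of Prop. 4.4, p. 10: after the blowing up of a closed point `x ∈ Σ`, the one-dimensional components of `Σ′`
are the strict transforms of those of `Σ`, together with at most the projective line `L_x` of near points (Lemma 4.3 (1) `τ = 3`: none;
(3) `τ = 2`: one closed near point; (5) `τ = 1`: near points on `L_x`); «each exceptional curve … created by the algorithm is regular».
Proof: off `x` = tree `IsBlowup.mem_maxPoints_setOf_le_idealOrder_iff` + `IsBlowup.closure_preimage_diff_support_eq_closure_singleton`
(`StrictTransformGenericPoint.lean`, p621389); over `x` = `IsBlowup.stalkTau_eq_one_of_isNear_of_not_isClosed`,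
`IsBlowup.isRegular_subscheme_closure_of_isNear_of_not_isClosed`, `IsBlowup.eq_or_disjoint_closure_of_isNear_of_not_isClosed`
(`NearPointsPointCentreLineCurve.lean`). `CossartPiltant2008_prop44` (F-71) is NOT proved by this; resolution in dimension `≥ 4` /
positive characteristic is NOT proved.
-/

-- `Summit.<Summit>.<Sub>.Theorems` with `Sub = Summit` (single-conjunct summit, D-0017)
set_option linter.dupNamespace false

noncomputable section

open CategoryTheory AlgebraicGeometry TopologicalSpace IsLocalRing
open Literature.AlgebraicGeometry.Resolution Scheme.IdealSheafData

namespace Summit.ResolutionOfSingularities.ResolutionOfSingularities.Theorems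

namespace CP2008Prop44

universe u

/-- **ρ1′ — POINT-STEP BOOKKEEPING ([CoP1] Lemma 4.3 (1), (3), (5)).** `X` regular locally Noetherian of dimension `≤ 3`, `J`, `μ ≥ 1`,
`ord ≤ μ`, `V(J)` of codimension `≥ 2`; `x ∈ Σ` a closed threefold point; `π` the blowing up of `x`, `J′` the weak transform,
`Σ′ = {μ ≤ ord J′}`. For every maximal point `η′` of `Σ′` that is not closed (a curve of `Σ′`): EITHER `π η′ ≠ x`, `π η′` is a maximal point
of `Σ` and `cl{η′} = cl(π⁻¹(cl{π η′} ∖ {x}))`; OR `π η′ = x`, `cl{η′}` is a regular curve with an rsop pair at each of its points, and every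
other such curve of `Σ′` over `x` either IS it or is disjoint from it. (= the frozen ρ1 `pointStep_curves` with its last clause weakened from
«`η″ = η′`» to «`η″ = η′ ∨ Disjoint …`», bus 09:46:49Z.) [cite: CossartPiltant2008, Lemma 4.3 (1) (3) (5); Prop. 4.4 (proof, p. 10)] -/
theorem pointStep_curves' {X X' : Scheme.{u}} [IsLocallyNoetherian X] [IsLocallyNoetherian X'] (hX : Scheme.IsRegular X)
    (hX3 : topologicalKrullDim X ≤ 3) (J : X.IdealSheafData) {μ : ℕ} (hμ : 1 ≤ μ) (hle : ∀ z, idealOrder J z ≤ μ)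
    (hcodim : ∀ z ∈ J.support, 1 < Order.coheight z) {x : X} (hx : IsClosed ({x} : Set X)) (hord : idealOrder J x = μ)
    (hdim : (maximalIdeal (X.presheaf.stalk x)).spanFinrank = 3) {π : X' ⟶ X}
    (hπ : IsBlowup π (vanishingIdeal ⟨{x}, hx⟩)) {η' : X'}
    (hη' : η' ∈ maxPoints {z : X' | (μ : ℕ∞) ≤ idealOrder (controlledTransform π (vanishingIdeal ⟨{x}, hx⟩) J μ) z})
    (hη'cl : ¬ IsClosed ({η'} : Set X')) :
    (π η' ≠ x ∧ π η' ∈ maxPoints {z : X | (μ : ℕ∞) ≤ idealOrder J z} ∧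
        closure ({η'} : Set X') = closure (π ⁻¹' (closure {π η'} \ {x}))) ∨
      (π η' = x ∧ Scheme.IsRegular (vanishingIdeal (⟨closure {η'}, isClosed_closure⟩ : Closeds X')).subscheme ∧
        (∀ y ∈ closure ({η'} : Set X'), ∀ hr : IsRegularLocalRing (X'.presheaf.stalk y),
          ∃ c : Fin 2 → X'.presheaf.stalk y, @IsRsopPart _ _ _ 2 c ∧
            Ideal.span (Set.range c) = stalkIdeal (vanishingIdeal (⟨closure {η'}, isClosed_closure⟩ : Closeds X')) y) ∧
        ∀ η'' ∈ maxPoints {z : X' | (μ : ℕ∞) ≤ idealOrder (controlledTransform π (vanishingIdeal ⟨{x}, hx⟩) J μ) z},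
          ¬ IsClosed ({η''} : Set X') → π η'' = x → η'' = η' ∨ Disjoint (closure ({η'} : Set X')) (closure {η''})) := by
  have _h3 := hX3
  have _hl := hle
  have _hc := hcodim
  -- near points over `x`
  have hY : ∀ z ∈ ((⟨{x}, hx⟩ : Closeds X) : Set X), idealOrder J z = μ := by
    rintro z (rfl : z = x); exact hord
  have hnear_of : ∀ ζ : X', ζ ∈ maxPoints {z : X' | (μ : ℕ∞) ≤ idealOrder (controlledTransform π (vanishingIdeal ⟨{x}, hx⟩) J μ) z} →
      π ζ = x → IsNear π (vanishingIdeal ⟨{x}, hx⟩) J μ ζ := by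
    intro ζ hζ hζx
    have hge : (μ : ℕ∞) ≤ idealOrder (controlledTransform π (vanishingIdeal ⟨{x}, hx⟩) J μ) ζ := by
      have h := maxPoints_subset _ hζ
      simpa only [Set.mem_setOf_eq] using h
    have hle' : idealOrder (controlledTransform π (vanishingIdeal ⟨{x}, hx⟩) J μ) ζ ≤ μ :=
      hπ.idealOrder_controlledTransform_le_of_mem hX (isRegular_subscheme_vanishingIdeal_singleton hx) hY (by rw [hζx]; rfl)
    exact isNear_iff.mpr (le_antisymm hle' hge)
  by_cases hηx : π η' = x
  · right
    have hnear := hnear_of η' hη' hηx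
    have hτ : haveI := hX x; stalkTau J x μ = 1 :=
      hπ.stalkTau_eq_one_of_isNear_of_not_isClosed hX hx hμ hord hdim hηx hnear hη'cl
    obtain ⟨hreg, hpairs⟩ :=
      IsBlowup.isRegular_subscheme_closure_of_isNear_of_not_isClosed hX hx hπ hord hdim hτ hηx hnear hη'cl
    refine ⟨hηx, hreg, hpairs, fun η'' hη'' hη''cl hη''x => ?_⟩
    exact IsBlowup.eq_or_disjoint_closure_of_isNear_of_not_isClosed hX hx hπ hord hdim hτ hηx hnear hη'cl hη''x
      (hnear_of η'' hη'' hη''x) hη''cl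
  · left
    have hsupp : π η' ∉ ((vanishingIdeal (⟨{x}, hx⟩ : Closeds X)).support : Set X) := by
      rw [Scheme.IdealSheafData.coe_support_vanishingIdeal]; exact hηx
    refine ⟨hηx, (hπ.mem_maxPoints_setOf_le_idealOrder_iff J μ (μ : ℕ∞) hsupp).mp hη', ?_⟩
    have h := hπ.closure_preimage_diff_support_eq_closure_singleton (rfl : π η' = π η') hsupp
    rw [Scheme.IdealSheafData.coe_support_vanishingIdeal] at h
    exact h.symm

end CP2008Prop44

end Summit.ResolutionOfSingularities.ResolutionOfSingularities.Theorems

end
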